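import Mathlib
import Summits.AtomisticToContinuum.HydrodynamicLimit.Theses.ImplosionDichotomy

/-!
# Line `r2-one-mode-two-conditions` — skeleton for crux `DenseExcursion` (stmt-AtomisticToContinuum-12586)

Route `ImplosionDichotomy`, crux (rank 2)
`Summit.AtomisticToContinuum.HydrodynamicLimit.Theses.ImplosionDichotomy.DenseExcursion`:
there are `η > 0` and continuous positive profiles `(a₀, u₀, θ₀)` such that for every `σ₀ > 0` some
`σ ∈ (0, σ₀)` admits an ADMISSIBLE classical hard-sphere-Euler solution (its `t = 0` fields are the LLN
limit of the local Gibbs laws, for every flow family) whose packing `ρ σ³` reaches `η`.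

## The line (idea card `Ideas/r2-one-mode-two-conditions.md`, triage r1-1/2/3: pass)

Target the FIRST globally smooth self-similar implosion profile `SS(r₂)` of the monatomic gas
(`γ = 5/3`, `(d, ℓ) = (3, 3)`, `r₂ ≈ 1.1128162`). Its computed radial smooth-mode spectrum has exactly
ONE genuine unstable mode `Λ₁ ≈ 0.79711` against the packing clock `μ = 3(r₂ - 1) ≈ 0.33845`; since
`2μ < Λ₁ < 3μ`, a `σ`-INDEPENDENT profile reaches packing `η` iff the `σ³`- and `σ⁶`-coefficients
`K₁, K₂` of the unstable projection vanish: `(m, J) = (1, 2)`. The proof of the crux along this line is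

* statics: the admissible `t = 0` data are EXACTLY the local-equilibrium density `n^σ[a₀]`
  (`log n + μ_ex(n σ³) = log a₀ + const`, `∫ n = 1`) with `(u₀, θ₀)` — `stub_admissibleData`;
* `σ = 0`, ODE level: a smooth `(3,3)` profile with the `(1,2)` spectral package exists —
  `stub_oneModeProfile` (certified-numerics sized; three independent double-precision codes agree);
* `σ > 0`, generic PDE: local well-posedness + `C¹` continuation for the hard-sphere Euler system below a
  packing threshold where `Z` is smooth — `stub_wellPosedness`;
* `σ > 0`, the XL heart: forced modulation stability of the one-mode profile under the `O(packing)`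
  excluded-volume forcing and the `O(σ³)` data defect, with the two tuning conditions solved on the
  stable manifold (Kidder knob `b` for `K₁`, a stable-manifold direction for `K₂`) —
  `stub_tunedForcedImplosion`;

composed by pure logic in `DenseExcursion_of`, which takes the route's own support item
`HsEosLowDensity` (stmt-0768) as its only hypothesis.

## Definitions posited here (copy this block verbatim when proving a stub elsewhere)

`Delta/Delta1/Delta2`, `IsMonatomicProfile`, `linW/linS`, `IsRegularPair`, `IsSmoothRadialMode`,
`IsGeneralizedMode`, `OneModeTwoConditions`,
`excessChemicalPotential`, `EosRelated`, `ImplodesWithProfile`, `HsEulerWellPosedness`,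
`TunedImplosion`. Conventions (derived by hand in this seat, NOTES.md): radial velocity
`u = -R W /(r (T - t))`, sound speed `c = R S /(r (T - t))`, `y = R (T - t)^{-1/r}`, `x = log y`,
clock `T - t = T e^{-r τ}`; then `Δ W' = -Δ₁`, `Δ S' = -Δ₂` with `Δ = (1 - W)² - S²`
(Biasi 2021 §2, Merle–Raphaël–Rodnianski–Szeftel), centre `x → -∞` at `(S, W) = (∞, r - 1)`,
far field `x → +∞` at `(0, 0)`; ideal monatomic gas `c² = (5/3) θ`.
-/

noncomputable section

open Filter Set MeasureTheory
open scoped Topology ContDiff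

namespace Summit.AtomisticToContinuum.HydrodynamicLimit.Cruxes.DenseExcursion.R2OneModeTwoConditions

open Literature.MathematicalPhysics.KineticTheory
open Summit.AtomisticToContinuum.HydrodynamicLimit.Theses.ImplosionDichotomy

/-! ### §0 Definitions -/

/-- `Δ = (1 - W)² - S²` of the `(d, ℓ) = (3, 3)` self-similar phase portrait (sonic line `S = 1 - W`). -/
def Delta (S W : ℝ) : ℝ := (1 - W) ^ 2 - S ^ 2

/-- `Δ₁ = W (W - 1)(W - r) - 3 (W - (r - 1)) S²` for `(d, ℓ) = (3, 3)`. -/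
def Delta1 (r S W : ℝ) : ℝ := W * (W - 1) * (W - r) - 3 * (W - (r - 1)) * S ^ 2

/-- `Δ₂ = S (5 W² - (6 + 2 r) W + 3 r - 3 S²) / 3` for `(d, ℓ) = (3, 3)`. -/
def Delta2 (r S W : ℝ) : ℝ := S * (5 * W ^ 2 - (6 + 2 * r) * W + 3 * r - 3 * S ^ 2) / 3

/-- A GLOBALLY SMOOTH self-similar implosion profile of the monatomic gas with blow-up speed `r`:
`W, S` are `C^∞` functions of `x = log y ∈ ℝ` solving `Δ W' = -Δ₁`, `Δ S' = -Δ₂` (polynomial form,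
so smoothness ACROSS the sonic point is part of the definition and quantises `r`), `S > 0`, regular
at the centre (`W` and `y S` are smooth functions of `y²`, `y S → s(0) > 0`), and tending to the far-field
point `(S, W) = (0, 0)` as `x → +∞`; `1 < r < r* = 3 - √3`. -/
def IsMonatomicProfile (r : ℝ) (W S : ℝ → ℝ) : Prop :=
  1 < r ∧ r < 3 - Real.sqrt 3 ∧
  ContDiff ℝ ∞ W ∧ ContDiff ℝ ∞ S ∧ (∀ x, 0 < S x) ∧
  (∀ x, Delta (S x) (W x) * deriv W x = -Delta1 r (S x) (W x) ∧
        Delta (S x) (W x) * deriv S x = -Delta2 r (S x) (W x)) ∧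
  (∃ w s : ℝ → ℝ, ContDiff ℝ ∞ w ∧ ContDiff ℝ ∞ s ∧ 0 < s 0 ∧
      ∀ x, W x = w (Real.exp (2 * x)) ∧ Real.exp x * S x = s (Real.exp (2 * x))) ∧
  Tendsto W atTop (𝓝 0) ∧ Tendsto S atTop (𝓝 0)

/-- Right-hand side (the `W`-component of the linearised operator `L`) of the radial isentropic Euler
system linearised in self-similar variables around the profile `(W, S)`, acting on a perturbation
`(ŵ, ŝ) : ℝ → ℂ²` (functions of `x = log y`): `(W - 1) ŵ' + 3 S ŝ' + (W' + 2 W - r) ŵ + (3 S' + 6 S) ŝ`. -/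
def linW (r : ℝ) (W S : ℝ → ℝ) (ŵ ŝ : ℝ → ℂ) (x : ℝ) : ℂ :=
  ((W x - 1 : ℝ) : ℂ) * deriv ŵ x + ((3 * S x : ℝ) : ℂ) * deriv ŝ x +
    ((deriv W x + 2 * W x - r : ℝ) : ℂ) * ŵ x + ((3 * deriv S x + 6 * S x : ℝ) : ℂ) * ŝ x

/-- The `S`-component of the linearised operator: `(S/3) ŵ' + (W - 1) ŝ' + (S' + 2 S) ŵ + (W'/3 + 2 W - r) ŝ`. -/
def linS (r : ℝ) (W S : ℝ → ℝ) (ŵ ŝ : ℝ → ℂ) (x : ℝ) : ℂ :=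
  ((S x / 3 : ℝ) : ℂ) * deriv ŵ x + ((W x - 1 : ℝ) : ℂ) * deriv ŝ x +
    ((deriv S x + 2 * S x : ℝ) : ℂ) * ŵ x + ((deriv W x / 3 + 2 * W x - r : ℝ) : ℂ) * ŝ x

/-- A smooth radial perturbation REGULAR AT THE CENTRE: `ŵ, ŝ` are `C^∞` in `x = log y` and `ŵ`, `y ŝ`
are smooth functions of `y²` (so that `δu = -R ŵ/(r(T-t))`, `δc = R ŝ/(r(T-t))` are smooth radial fields). -/
def IsRegularPair (ŵ ŝ : ℝ → ℂ) : Prop :=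
  ContDiff ℝ ∞ ŵ ∧ ContDiff ℝ ∞ ŝ ∧
    ∃ f g : ℝ → ℂ, ContDiff ℝ ∞ f ∧ ContDiff ℝ ∞ g ∧
      ∀ x, ŵ x = f (Real.exp (2 * x)) ∧ (Real.exp x : ℂ) * ŝ x = g (Real.exp (2 * x))

/-- A SMOOTH RADIAL (linear) MODE with growth rate `Λ ∈ ℂ` of the profile `(W, S)` (clock
`T - t = T e^{-rτ}`, perturbations `∝ e^{Λτ}`): a non-trivial centre-regular `C^∞` solution of
`Λ ŵ = linW`, `Λ ŝ = linS`. Smoothness across the sonic point excludes Biasi's continuum of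
finitely-regular modes; `Λ = r` (blow-up time) and `Λ = 0` (scaling) are the symmetry modes. -/
def IsSmoothRadialMode (r : ℝ) (W S : ℝ → ℝ) (Λ : ℂ) (ŵ ŝ : ℝ → ℂ) : Prop :=
  IsRegularPair ŵ ŝ ∧ (∃ x, ŵ x ≠ 0 ∨ ŝ x ≠ 0) ∧
    ∀ x, Λ * ŵ x = linW r W S ŵ ŝ x ∧ Λ * ŝ x = linS r W S ŵ ŝ x

/-- A GENERALISED (Jordan) smooth radial mode over the mode `(ŵ₁, ŝ₁)` at `Λ`: a centre-regular smooth
solution of `(L - Λ)(ŵ₂, ŝ₂) = (ŵ₁, ŝ₁)`. Its non-existence is algebraic simplicity of `Λ`. -/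
def IsGeneralizedMode (r : ℝ) (W S : ℝ → ℝ) (Λ : ℂ) (ŵ₁ ŝ₁ ŵ₂ ŝ₂ : ℝ → ℂ) : Prop :=
  IsRegularPair ŵ₂ ŝ₂ ∧
    ∀ x, Λ * ŵ₂ x + ŵ₁ x = linW r W S ŵ₂ ŝ₂ x ∧ Λ * ŝ₂ x + ŝ₁ x = linS r W S ŵ₂ ŝ₂ x

/-- The `(m, J) = (1, 2)` package of the line: a globally smooth monatomic profile whose smooth radial
point spectrum in `Re Λ > 0` consists of the symmetry mode `Λ = r` and EXACTLY ONE genuine unstable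
mode `Λ₁`, algebraically simple, with `2μ < Λ₁ < 3μ` for the packing clock `μ = 3 (r - 1)` (so an
untuned `σ³`-seed and a `σ⁶`-seed are both amplified to `O(1)` before packing `η`, a `σ⁹`-seed is not:
two tuning conditions, one unstable direction). Computed at `r₂ ≈ 1.1128162`:
`Λ₁ ≈ 0.79711 ∈ (6(r₂-1), 9(r₂-1)) = (0.677, 1.015)`. -/
def OneModeTwoConditions (r : ℝ) (W S : ℝ → ℝ) : Prop :=
  IsMonatomicProfile r W S ∧
  ∃ Λ₁ : ℝ, 6 * (r - 1) < Λ₁ ∧ Λ₁ < 9 * (r - 1) ∧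
    (∃ ŵ ŝ : ℝ → ℂ, IsSmoothRadialMode r W S (Λ₁ : ℂ) ŵ ŝ) ∧
    (∀ ŵ₁ ŝ₁ : ℝ → ℂ, IsSmoothRadialMode r W S (Λ₁ : ℂ) ŵ₁ ŝ₁ →
      ∀ ŵ₂ ŝ₂ : ℝ → ℂ, ¬ IsGeneralizedMode r W S (Λ₁ : ℂ) ŵ₁ ŝ₁ ŵ₂ ŝ₂) ∧
    ∀ Λ : ℂ, 0 < Λ.re → (∃ ŵ ŝ : ℝ → ℂ, IsSmoothRadialMode r W S Λ ŵ ŝ) →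
      Λ = (Λ₁ : ℂ) ∨ Λ = (r : ℂ)

/-- The excess chemical potential `β μ_ex(η) = f_ex(η) + η f_ex'(η)` of the hard-sphere fluid at reduced
density `η` (`f_ex = hsExcessFreeEnergy`; equals `(4π/3) η + O(η²)` where the virial series converges). -/
def excessChemicalPotential (η : ℝ) : ℝ :=
  hsExcessFreeEnergy η + η * deriv hsExcessFreeEnergy η

/-- `n` is the LOCAL-EQUILIBRIUM DENSITY of the activity profile `a₀` at reduced diameter `σ`: the
continuous positive unit-mass solution of the bulk equation-of-state relation
`log n(x) + β μ_ex(n(x) σ³) = log a₀(x) + const` on the dilute branch `n ≤ 2 a₀/∫a₀` (which excludes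
spurious roots in the range where `hsExcessFreeEnergy` is `limsup`/`deriv` junk). For small `σ` it is
unique, as smooth as `a₀`, and equals `n₀ - (4π/3) σ³ n₀ (n₀ - ∫ n₀²) + O(σ⁶)`, `n₀ = a₀/∫a₀` (the
canonical excluded-volume data defect; cdisprove §5b proves the two-sided `O(σ³)` bound). -/
def EosRelated (σ : ℝ) (a₀ n : T3 → ℝ) : Prop :=
  Continuous n ∧ (∀ x, 0 < n x) ∧ (∀ x, n x ≤ 2 * (a₀ x / ∫ y, a₀ y)) ∧ (∫ x, n x) = 1 ∧
    ∃ c : ℝ, ∀ x, Real.log (n x) + excessChemicalPotential (n x * σ ^ 3) = Real.log (a₀ x) + c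

/-- The classical solution `(ρ₁, u₁, θ₁)` on `[0, T)` IMPLODES at the point `x₀` at time `T` with the
self-similar profile `(r, W, S)`: along every ray `x = x₀ + (T - t)^{1/r} v` inside the closed sonic cone
(`1 - W ≤ S` at `x = log ‖v‖`) the rescaled density, velocity and temperature converge as `t ↑ T` to
`κ (‖v‖ S / r)³`, `-(W / r) v`, `(3/5) (‖v‖ S / r)²` (ideal monatomic gas: `c² = (5/3) θ`, `ρ ∝ c³`). -/
def ImplodesWithProfile (r : ℝ) (W S : ℝ → ℝ) (T : ℝ) (x₀ : T3) (ρ₁ θ₁ : ℝ → T3 → ℝ)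
    (u₁ : ℝ → T3 → V3) : Prop :=
  ∃ κ : ℝ, 0 < κ ∧ ∀ v : V3, v ≠ 0 → 1 - W (Real.log ‖v‖) ≤ S (Real.log ‖v‖) →
    Tendsto (fun t : ℝ => (T - t) ^ (3 * (1 - 1 / r)) *
        ρ₁ t (x₀ + Literature.Analysis.FunctionSpaces.Torus.proj ((T - t) ^ (1 / r) • v)))
      (𝓝[<] T) (𝓝 (κ * (‖v‖ * S (Real.log ‖v‖) / r) ^ 3)) ∧
    Tendsto (fun t : ℝ => (T - t) ^ (1 - 1 / r) •
        u₁ t (x₀ + Literature.Analysis.FunctionSpaces.Torus.proj ((T - t) ^ (1 / r) • v)))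
      (𝓝[<] T) (𝓝 ((-(W (Real.log ‖v‖) / r)) • v)) ∧
    Tendsto (fun t : ℝ => (T - t) ^ (2 * (1 - 1 / r)) *
        θ₁ t (x₀ + Literature.Analysis.FunctionSpaces.Torus.proj ((T - t) ^ (1 / r) • v)))
      (𝓝[<] T) (𝓝 (3 / 5 * (‖v‖ * S (Real.log ‖v‖) / r) ^ 2))

/-- LOCAL WELL-POSEDNESS WITH `C¹` CONTINUATION for the hard-sphere Euler system below a packing
threshold on which the compressibility factor `Z = hsCompressibility` is smooth (Kato 1975 / Majda 1984
for the symmetric-hyperbolic system `p = ρ θ Z(ρ σ³)`): given `η₀ > 0` with `Z` smooth on `[0, η₀]`,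
there is `η₁ ∈ (0, η₀]` such that (i) smooth positive data of packing `< η₁` launch a classical solution
on some `[0, T)`, `T > 0`; (ii) a classical solution on `[0, T)` with packing `≤ η₁/2`, density and
temperature in `[M⁻¹, M]`-type bounds and uniformly bounded first space derivatives extends classically
beyond `T`. -/
def HsEulerWellPosedness : Prop :=
  ∀ η₀ : ℝ, 0 < η₀ →
    (∃ Z : ℝ → ℝ, ContDiff ℝ ∞ Z ∧ Set.EqOn hsCompressibility Z (Set.Icc 0 η₀)) →
    ∃ η₁ : ℝ, 0 < η₁ ∧ η₁ ≤ η₀ ∧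
      (∀ σ : ℝ, 0 < σ → ∀ (ρ₀ θ₀ : T3 → ℝ) (u₀ : T3 → V3),
        Literature.Analysis.FunctionSpaces.Torus.IsSmooth ρ₀ →
        Literature.Analysis.FunctionSpaces.Torus.IsSmooth θ₀ →
        Literature.Analysis.FunctionSpaces.Torus.IsSmooth u₀ →
        (∀ x, 0 < ρ₀ x) → (∀ x, 0 < θ₀ x) → (∀ x, ρ₀ x * σ ^ 3 < η₁) →
        ∃ T : ℝ, 0 < T ∧ ∃ (ρ θ : ℝ → T3 → ℝ) (u : ℝ → T3 → V3),
          IsHardSphereEulerSolution σ T ρ u θ ∧ ρ 0 = ρ₀ ∧ u 0 = u₀ ∧ θ 0 = θ₀) ∧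
      (∀ σ : ℝ, 0 < σ → ∀ T : ℝ, 0 < T → ∀ (ρ θ : ℝ → T3 → ℝ) (u : ℝ → T3 → V3),
        IsHardSphereEulerSolution σ T ρ u θ →
        (∃ M : ℝ, ∀ t ∈ Set.Ico 0 T, ∀ x, ρ t x * σ ^ 3 ≤ η₁ / 2 ∧ M⁻¹ ≤ ρ t x ∧ M⁻¹ ≤ θ t x ∧
            θ t x ≤ M ∧ ‖u t x‖ ≤ M ∧
            ‖Literature.Analysis.FunctionSpaces.Torus.fderiv (ρ t) x‖ ≤ M ∧
            ‖Literature.Analysis.FunctionSpaces.Torus.fderiv (u t) x‖ ≤ M ∧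
            ‖Literature.Analysis.FunctionSpaces.Torus.fderiv (θ t) x‖ ≤ M) →
        ∃ T₂ : ℝ, T < T₂ ∧ ∃ (ρ' θ' : ℝ → T3 → ℝ) (u' : ℝ → T3 → V3),
          IsHardSphereEulerSolution σ T₂ ρ' u' θ' ∧ ∀ t ∈ Set.Ico 0 T, ρ' t = ρ t ∧ u' t = u t ∧ θ' t = θ t)

/-- TUNED FORCED IMPLOSION along the profile `(r, W, S)`: there are `η > 0` and `σ`-INDEPENDENT continuous
positive profiles `(a₀, u₀, θ₀)` such that (i) the ideal (`σ = 0`) development of `(a₀/∫a₀, u₀, θ₀)` is a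
classical solution on some `[0, T)` imploding at a point `x₀` at time `T` with profile `(r, W, S)` (the
profile lies on the stable manifold of `SS(r)`), and (ii) for every small `σ > 0` and every local-equilibrium
density `n` of `(a₀, σ)` there is a classical hard-sphere-Euler solution with data `(n, u₀, θ₀)` whose
packing reaches `η` — i.e. the two tuning conditions `K₁ = K₂ = 0` are met at this profile. -/
def TunedImplosion (r : ℝ) (W S : ℝ → ℝ) : Prop :=
  ∃ η : ℝ, 0 < η ∧ ∃ (a₀ θ₀ : T3 → ℝ) (u₀ : T3 → V3),
    Continuous a₀ ∧ Continuous θ₀ ∧ Continuous u₀ ∧ (∀ x, 0 < a₀ x) ∧ (∀ x, 0 < θ₀ x) ∧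
    (∃ (x₀ : T3) (T : ℝ) (ρ₁ θ₁ : ℝ → T3 → ℝ) (u₁ : ℝ → T3 → V3), 0 < T ∧
        IsHardSphereEulerSolution 0 T ρ₁ u₁ θ₁ ∧ (ρ₁ 0 = fun x => a₀ x / ∫ y, a₀ y) ∧ u₁ 0 = u₀ ∧
        θ₁ 0 = θ₀ ∧ ImplodesWithProfile r W S T x₀ ρ₁ θ₁ u₁) ∧
    ∃ σ₁ : ℝ, 0 < σ₁ ∧ ∀ σ : ℝ, 0 < σ → σ < σ₁ → ∀ n : T3 → ℝ, EosRelated σ a₀ n →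
      ∃ (T' : ℝ) (ρ θ : ℝ → T3 → ℝ) (u : ℝ → T3 → V3), IsHardSphereEulerSolution σ T' ρ u θ ∧
        ρ 0 = n ∧ u 0 = u₀ ∧ θ 0 = θ₀ ∧ ∃ t ∈ Set.Ico 0 T', ∃ x, η ≤ ρ t x * σ ^ 3

/-! ### §1 The stubs (registered; `sorry` only here) -/

/-- STUB 1 (statics, size L): IDENTIFICATION OF ADMISSIBLE DATA. For continuous positive profiles and
small `σ`, the local-equilibrium density `n = n^σ[a₀]` of `EosRelated` exists and the canonical local Gibbs
laws are probability measures whose empirical density / momentum / energy fields at `t = 0` satisfy the law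
of large numbers towards `(n, n u₀, n(|u₀|²/2 + 3θ₀/2))` for every flow family — hence every field triple
with these `t = 0` values carries the admissibility tie of `DenseExcursion`. (Sharpens route support
`LocalGibbsDensityLimit` from `ε`-closeness to the exact bulk EOS relation; the two-sided `O(σ³)` bound is
cdisprove §5b. Uses the tie — the hypothesis Disproof §3 shows to be load-bearing.)
Sources: Ruelle1969 §3.4, LebowitzPenrose1964, Spohn1991 Part I Ch. 3. -/
theorem stub_admissibleData :
    HsEosLowDensity →
    ∀ (a₀ θ₀ : T3 → ℝ) (u₀ : T3 → V3), Continuous a₀ → Continuous θ₀ → Continuous u₀ →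
      (∀ x, 0 < a₀ x) → (∀ x, 0 < θ₀ x) →
      ∃ σ₀ : ℝ, 0 < σ₀ ∧ ∀ σ : ℝ, 0 < σ → σ < σ₀ →
        ∃ n : T3 → ℝ, EosRelated σ a₀ n ∧
          ∀ (ρ θ : ℝ → T3 → ℝ) (u : ℝ → T3 → V3), ρ 0 = n → u 0 = u₀ → θ 0 = θ₀ →
            ∀ Φ : (N : ℕ) → Literature.Analysis.FluidPDE.HardSphereFlow
                (Literature.Analysis.FluidPDE.Torus.geometry (Fin 3)) (hsDiameter σ N) (N + 1),
              (∀ N, IsProbabilityMeasure (localGibbsLaw σ a₀ u₀ θ₀ N (Φ N))) ∧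
              TendstoHydroFieldsAt (fun N => localGibbsLaw σ a₀ u₀ θ₀ N (Φ N)) Φ ρ u θ 0 := by
  sorry

/-- STUB 2 (`σ = 0`, ODE level, size L — certified-numerics sized): THE ONE-MODE PROFILE. There is a globally
smooth self-similar implosion profile of the monatomic gas in the Buckmaster–CaoLabora–GómezSerrano bracket
`r ∈ (1.10, 1.135)` (computed: `r₂ = 1.11281615`, sonic regularity `ν = 3.3049`) carrying the `(m, J) = (1, 2)`
package: unique genuine unstable smooth radial mode `Λ₁ = 0.79711 ∈ (6(r-1), 9(r-1)) = (0.677, 1.015)`, no other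
smooth radial point spectrum in `Re Λ > 0` besides the gauge mode `Λ = r` (three independent codes: kit j006166,
j007023, j007096/j007007 + cdisprove 32-digit run; argument principle on `[0.05,3]×[-8,8]`; NOT interval-certified).
Sources: BuckmasterCaolaboraGomezserrano2025 (profiles, γ = 5/3), Biasi2021 arXiv:2104.05728 §3 (SLM), RaceResults.md. -/
theorem stub_oneModeProfile :
    ∃ (r : ℝ) (W S : ℝ → ℝ), (11 / 10 < r ∧ r < 227 / 200) ∧ OneModeTwoConditions r W S := by
  sorry

/-- STUB 3 (`σ > 0`, generic hyperbolic PDE, size M–L): local well-posedness and `C¹` continuation for the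
hard-sphere Euler system below a packing threshold where `Z` is smooth (`HsEulerWellPosedness`).
Sources: Kato1975, Majda1984 (Thm 2.1–2.2: continuation while `‖∇(ρ,u,θ)‖_∞` stays integrable). -/
theorem stub_wellPosedness : HsEulerWellPosedness := by
  sorry

/-- STUB 4 (`σ > 0`, size XL — THE HARDEST, load-bearing): TUNED FORCED MODULATION STABILITY. For every profile
with the `(1, 2)` package, given the analytic low-density equation of state (route item `HsEosLowDensity`) and
well-posedness, there are `σ`-independent profiles realising `TunedImplosion`: internally (line card §Stubs)
M0 radial codimension-one stable manifold of `SS(r)` at `σ = 0` (cone locality makes the admissible solution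
radial in the backward acoustic cone); M1 forced modulation in self-similar variables with forcing `O(packing)`
`∝ σ³ e^{μτ}` and data defect `σ³ h₁ + σ⁶ h₂ + O(σ⁹)` — tuning curve `s_*(b, σ) = σ³ K₁(b) + σ⁶ K₂(b) + O(σ⁹)`,
window `|s - s_*| < c σ^{3Λ₁/μ}`, `3Λ₁/μ ≈ 7.07 < 9`; M2 a common zero of `(K₁, K₂)`: `K₁` is a CUBIC in the Kidder
knob `λ* = 1 + bT` (projective symmetry of the `γ = 5/3` gas), `K₂` needs one stable-manifold direction; M3 = STUB 3.
Why it might fail: `K₁` of one sign on the whole knob and `K₂` not reachable — then `SS(r₂)` is dead and `J = 4` at `r₄`.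
Sources: CaolaboraEtAl2025 arXiv:2310.05325 Thm 1.2, MerleEtAl2022, Biasi2021, Kidder1974, Serre1997, ChenShkollerVicol2026. -/
theorem stub_tunedForcedImplosion :
    ∀ (r : ℝ) (W S : ℝ → ℝ), OneModeTwoConditions r W S → HsEosLowDensity → HsEulerWellPosedness →
      TunedImplosion r W S := by
  sorry

/-! ### §2 Composition (kernel-checked, no stub inside): the four stubs and route item 0768 give the crux -/

/-- `DenseExcursion` from the four stubs, with the route's support item `HsEosLowDensity` (stmt-0768) as the
only hypothesis: take the one-mode profile (STUB 2), the tuned forced implosion along it (STUB 4, fed STUB 3),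
and for `σ < min(σ₀, σ₀', σ₁)` the local-equilibrium density `n` with its LLN (STUB 1); the `σ`-solution
from `(n, u₀, θ₀)` is admissible because the tie only sees the `t = 0` fields, and it reaches packing `η`. -/
theorem DenseExcursion_of (hZ : HsEosLowDensity) : DenseExcursion := by
  obtain ⟨r, W, S, -, hpkg⟩ := stub_oneModeProfile
  obtain ⟨η, hη, a₀, θ₀, u₀, ha, hθ, hu, ha0, hθ0, -, σ₁, hσ₁, H⟩ :=
    stub_tunedForcedImplosion r W S hpkg hZ stub_wellPosedness
  obtain ⟨σ₀', hσ₀', G⟩ := stub_admissibleData hZ a₀ θ₀ u₀ ha hθ hu ha0 hθ0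
  refine ⟨η, hη, a₀, θ₀, u₀, ha, hθ, hu, ha0, hθ0, ?_⟩
  intro σ₀ hσ₀
  obtain ⟨σ, hσpos, hσlt⟩ : ∃ σ : ℝ, 0 < σ ∧ σ < min σ₀ (min σ₀' σ₁) :=
    exists_between (lt_min hσ₀ (lt_min hσ₀' hσ₁))
  have h1 : σ < σ₀ := lt_of_lt_of_le hσlt (min_le_left _ _)
  have h2 : σ < σ₀' := lt_of_lt_of_le hσlt ((min_le_right _ _).trans (min_le_left _ _))
  have h3 : σ < σ₁ := lt_of_lt_of_le hσlt ((min_le_right _ _).trans (min_le_right _ _))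
  obtain ⟨n, hn, hLLN⟩ := G σ hσpos h2
  obtain ⟨T', ρ, θ, u, hE, hρ0, hu0, hθ0', t, ht, x, hx⟩ := H σ hσpos h3 n hn
  refine ⟨σ, hσpos, h1, T', ρ, θ, u, hE, ?_, t, ht, x, hx⟩
  intro Φ
  exact (hLLN ρ θ u hρ0 hu0 hθ0' Φ).2

end Summit.AtomisticToContinuum.HydrodynamicLimit.Cruxes.DenseExcursion.R2OneModeTwoConditions

end
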